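import Summits.CriticalPhenomena.PercolationContinuityZ3.Theorems.Transplant.SkelNegBParamsFaceFloorsLXA
import Summits.CriticalPhenomena.PercolationContinuityZ3.Theorems.Transplant.SkelNegBParamsFaceCountsShiftA
import HarnessLib

/-!
# N1 params, M3 part 2b — **THE x-FACE's TRANSVERSE TARGET FLOORS `FL3`/`FL4`** (the last core of the tangential y′-run lands in the arrival box
# along axis `1`) at the (ζ′) tuple: the tangential run ends within `2u₁` of the target (`N3X_spec`), the cross shift moves the ordinate reading
# by `≤ 2` (`F1cA_yTX0_sub_abs_le`), and the last core's level extent `u₁·U·(yCoreHiS − yCoreLoS)/m ≈ 3u₁` fits the box half-width `10·Kq·u₁ − 2`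
(p3-g12, M3 pen, 2026-08-22; fields `FloorsX2.FL3/FL4` (SkelPhiFaceNumsXP2 :78–:81) at M3-FLOORS-SIGNATURE §1; envelope conditions = `floorsL_conds`).
* `envT` — `u₁·(nℓ + U·Z) ≤ m·(10Kq·u₁ − 2u₁ − 5)`, `Z = 2k + (1000Kq + k)·RA′ + 6`; `coreLo_env`, `coreHi_env`; `yCS_one/_neg`;
* **`FL3_XA_gen`/`FL4_XA_gen`** (any origin `yL`, `σT = ±1`, core index `k` with `|F1cA yL + σT·u₁·k − T1X| ≤ 2u₁`); **`FL3_XA`/`FL4_XA`** pinned.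
builds on p205010 (kernel theorem, internal audit signed; external expert review pending) — nothing in this file uses p205010; NOTHING is claimed about the node
`SamePDropOfSkeletonNeg₁` (OPEN); arithmetic only.
Lane `prim-bschramm-*`, seat `prim-bschramm-p3` (gen 12); helper file (`--supports stmt-CriticalPhenomena-4575 --as helper`).
[cite: KozmaNitzan2024, §4 Lemma 12 (pp. 23–25)] [cite: MartineauTassion2017, §4.1]
-/

noncomputable section

open scoped Classical

namespace Summit.CriticalPhenomena.PercolationContinuityZ3.Theorems.Transplant

namespace PlanarSkeletonNeg

namespace NegB

open Literature.Probability.Percolation Literature.Probability.LatticeModels SimpleGraph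
open Literature.Probability.Percolation.KozmaNitzan.Cells (oth sgOf sgOf_sign)
open SkelConc (Consts)
open Skelφ (shearUnit shearUnit_pos yCoreLoS yCoreHiS yCSLo yCSHi crossOffX)
open Skelφ.StepI (DataN)
open TwoAxis.Para (modulus coarse lam0 lam1)
open Neg

namespace KS

section FloorsL2

variable (κ : Consts) {V : Type} [DecidableEq V] [Countable V] {G : SimpleGraph V} [G.LocallyFinite] (Φ : PlanarSkeletonNeg G) (t : V)
  (p : unitInterval) (D : DataN V) (g f mk : ℕ)

/-- **The transverse master envelope**: `u₁·(nℓ + U·Z) ≤ m·(10Kq·u₁ − 2u₁ − 5)` with `Z := 2k + (1000Kq + k)·RA′ + 6`, under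
`11·(2k + (k + 1000Kq)·RA′ + 8) ≤ 2ℓ_L`. [folklore] -/
theorem envT (hN : EqNumL κ Φ t p D g f) (hκ : (hL κ Φ t p D g f).natAbs ≤ 10 * nL κ Φ t p D g f) {k : ℕ}
    (hℓ : 11 * (2 * (k : ℤ) + ((k : ℤ) + 1000 * Neg.Kq κ) * (RA' κ Φ t p D mk : ℤ) + 8) ≤ 2 * (ℓL κ Φ t p D g f : ℤ)) :
    u₁A κ Φ t p D g f * ((nL κ Φ t p D g f : ℤ) * (ℓL κ Φ t p D g f : ℤ) +
        (shearUnit (nL κ Φ t p D g f) (hL κ Φ t p D g f) : ℤ) * (2 * (k : ℤ) + (1000 * (Neg.Kq κ : ℤ) + k) * (RA' κ Φ t p D mk : ℤ) + 6)) ≤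
      modulus (nL κ Φ t p D g f) (hL κ Φ t p D g f) (vL κ Φ t p D g f) (vβL κ Φ t p D g f) * (10 * (Neg.Kq κ : ℤ) * u₁A κ Φ t p D g f - 2 * u₁A κ Φ t p D g f - 5) := by
  obtain ⟨hn1, hℓ1⟩ := one_le_of_eqNumL κ Φ t p D g f hN
  have hm1 := modulus_gt κ Φ t p D g f hN
  obtain ⟨hU1, hU2⟩ := clr_shearUnit_bounds κ Φ t p D g f hκ
  have hu : 1 ≤ u₁A κ Φ t p D g f := (units_eqA κ Φ t p D g f).2.2.2.2.2.2.2
  have hq : (1 : ℤ) ≤ Neg.Kq κ := by exact_mod_cast Neg.one_le_Kq κ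
  have hn1' : (1 : ℤ) ≤ (nL κ Φ t p D g f : ℤ) := by exact_mod_cast hn1
  have hℓ1' : (1 : ℤ) ≤ (ℓL κ Φ t p D g f : ℤ) := by exact_mod_cast hℓ1
  set n : ℤ := (nL κ Φ t p D g f : ℤ)
  set ℓ : ℤ := (ℓL κ Φ t p D g f : ℤ)
  set m := modulus (nL κ Φ t p D g f) (hL κ Φ t p D g f) (vL κ Φ t p D g f) (vβL κ Φ t p D g f)
  set U : ℤ := (shearUnit (nL κ Φ t p D g f) (hL κ Φ t p D g f) : ℤ)
  set u := u₁A κ Φ t p D g f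
  set Q : ℤ := (Neg.Kq κ : ℤ)
  set R : ℤ := (RA' κ Φ t p D mk : ℤ)
  have hk0 : (0 : ℤ) ≤ k := by positivity
  have hR0 : 0 ≤ R := by positivity
  have hZ0 : 0 ≤ 2 * (k : ℤ) + (1000 * Q + k) * R + 6 := by positivity
  -- `U·Z ≤ 11n·Z`, `m·X ≥ (nℓ − n)·X`, `X := 10Qu − 2u − 5 ≥ 8u − 5`
  have h1 : U * (2 * (k : ℤ) + (1000 * Q + k) * R + 6) ≤ 11 * n * (2 * (k : ℤ) + (1000 * Q + k) * R + 6) := mul_le_mul_of_nonneg_right hU2 hZ0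
  have hX : 8 * u - 5 ≤ 10 * Q * u - 2 * u - 5 := by nlinarith
  have hX0 : 0 ≤ 10 * Q * u - 2 * u - 5 := by linarith
  have h2 : (n * (ℓ - 1)) * (10 * Q * u - 2 * u - 5) ≤ m * (10 * Q * u - 2 * u - 5) := mul_le_mul_of_nonneg_right hm1.le hX0
  have h3 : (n * (ℓ - 1)) * (8 * u - 5) ≤ (n * (ℓ - 1)) * (10 * Q * u - 2 * u - 5) := mul_le_mul_of_nonneg_left hX (by nlinarith)
  -- the linear floor `11Z + 8 ≤ 2ℓ − 14`
  have h4 : n * (u * (11 * (2 * (k : ℤ) + (1000 * Q + k) * R + 6) + 8)) ≤ n * (u * (2 * ℓ - 14)) :=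
    mul_le_mul_of_nonneg_left (mul_le_mul_of_nonneg_left (by linarith) (by linarith)) (by linarith)
  have h5 : u * (U * (2 * (k : ℤ) + (1000 * Q + k) * R + 6)) ≤ u * (11 * n * (2 * (k : ℤ) + (1000 * Q + k) * R + 6)) := mul_le_mul_of_nonneg_left h1 (by linarith)
  have h6 : n * ℓ ≤ u * (n * ℓ) := le_mul_of_one_le_left (by positivity) hu
  have h7 : 0 ≤ n * u := by nlinarith
  nlinarith

/-- `U·⌊(nℓ − U + 1)/U⌋ ≥ nℓ − 2U + 2` and `U·(⌊nℓ/U⌋ + 1) ≤ nℓ + U`, `⌊(nℓ − U + 1)/U⌋ ≤ ⌊nℓ/U⌋ + 1`. [folklore] -/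
theorem strideS_bounds (hN : EqNumL κ Φ t p D g f) :
    (nL κ Φ t p D g f : ℤ) * (ℓL κ Φ t p D g f : ℤ) - 2 * (shearUnit (nL κ Φ t p D g f) (hL κ Φ t p D g f) : ℤ) + 2 ≤
        (shearUnit (nL κ Φ t p D g f) (hL κ Φ t p D g f) : ℤ) *
          (((nL κ Φ t p D g f : ℤ) * (ℓL κ Φ t p D g f) - (shearUnit (nL κ Φ t p D g f) (hL κ Φ t p D g f) : ℕ) + 1) / (shearUnit (nL κ Φ t p D g f) (hL κ Φ t p D g f) : ℕ)) ∧
      (shearUnit (nL κ Φ t p D g f) (hL κ Φ t p D g f) : ℤ) * ((nL κ Φ t p D g f : ℤ) * (ℓL κ Φ t p D g f) / (shearUnit (nL κ Φ t p D g f) (hL κ Φ t p D g f) : ℕ) + 1) ≤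
        (nL κ Φ t p D g f : ℤ) * (ℓL κ Φ t p D g f : ℤ) + (shearUnit (nL κ Φ t p D g f) (hL κ Φ t p D g f) : ℤ) ∧
      ((nL κ Φ t p D g f : ℤ) * (ℓL κ Φ t p D g f) - (shearUnit (nL κ Φ t p D g f) (hL κ Φ t p D g f) : ℕ) + 1) / (shearUnit (nL κ Φ t p D g f) (hL κ Φ t p D g f) : ℕ) ≤
        (nL κ Φ t p D g f : ℤ) * (ℓL κ Φ t p D g f) / (shearUnit (nL κ Φ t p D g f) (hL κ Φ t p D g f) : ℕ) + 1 := by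
  obtain ⟨hn1, -⟩ := one_le_of_eqNumL κ Φ t p D g f hN
  have hU0 : 0 < (shearUnit (nL κ Φ t p D g f) (hL κ Φ t p D g f) : ℤ) := shearUnit_pos hn1 _
  set U : ℤ := (shearUnit (nL κ Φ t p D g f) (hL κ Φ t p D g f) : ℤ)
  set N : ℤ := (nL κ Φ t p D g f : ℤ) * (ℓL κ Φ t p D g f)
  obtain ⟨a1, a2⟩ := RootArith.floor_sandwich (x := N - U + 1) (d := U) hU0
  obtain ⟨b1, b2⟩ := RootArith.floor_sandwich (x := N) (d := U) hU0
  refine ⟨by linarith, by nlinarith, ?_⟩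
  have : U * ((N - U + 1) / U) < U * (N / U + 1 + 1) := by nlinarith
  have := lt_of_mul_lt_mul_left this hU0.le
  omega

/-- **Lower-core envelope**: `m·(u₁k + 2u₁ + 5 − b₀₁) + u₁·U ≤ u₁·(U·yCoreLoS k) + 1` (`b₀₁ = 10Kq·u₁`). [folklore] -/
theorem coreLo_env (hN : EqNumL κ Φ t p D g f) (hκ : (hL κ Φ t p D g f).natAbs ≤ 10 * nL κ Φ t p D g f) {k : ℕ}
    (hℓ : 11 * (2 * (k : ℤ) + ((k : ℤ) + 1000 * Neg.Kq κ) * (RA' κ Φ t p D mk : ℤ) + 8) ≤ 2 * (ℓL κ Φ t p D g f : ℤ)) :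
    modulus (nL κ Φ t p D g f) (hL κ Φ t p D g f) (vL κ Φ t p D g f) (vβL κ Φ t p D g f) *
          (u₁A κ Φ t p D g f * k + 2 * u₁A κ Φ t p D g f + 5 - (b0TA κ Φ t p D g f 1 : ℤ)) +
        u₁A κ Φ t p D g f * (shearUnit (nL κ Φ t p D g f) (hL κ Φ t p D g f) : ℤ) ≤
      u₁A κ Φ t p D g f * ((shearUnit (nL κ Φ t p D g f) (hL κ Φ t p D g f) : ℤ) *
          yCoreLoS (nL κ Φ t p D g f) (ℓL κ Φ t p D g f) (hL κ Φ t p D g f) (qB3XA κ Φ t p D g f (RA' κ Φ t p D mk)) (RA' κ Φ t p D mk) k) + 1 := by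
  obtain ⟨hn1, hℓ1⟩ := one_le_of_eqNumL κ Φ t p D g f hN
  obtain ⟨hm1, hm2⟩ := Skelφ.NegPrm.modulus_vβOf hn1 (hL κ Φ t p D g f) (ℓL κ Φ t p D g f) (vL κ Φ t p D g f)
  obtain ⟨hU1, hU2⟩ := clr_shearUnit_bounds κ Φ t p D g f hκ
  obtain ⟨hs1, hs2, -⟩ := strideS_bounds κ Φ t p D g f hN
  have henv := envT κ Φ t p D g f mk hN hκ hℓ
  have hu : 1 ≤ u₁A κ Φ t p D g f := (units_eqA κ Φ t p D g f).2.2.2.2.2.2.2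
  have hb : (b0TA κ Φ t p D g f 1 : ℤ) = 10 * (Neg.Kq κ : ℤ) * u₁A κ Φ t p D g f := (units_eqA κ Φ t p D g f).2.2.2.2.2.1
  have hq : (1 : ℤ) ≤ Neg.Kq κ := by exact_mod_cast Neg.one_le_Kq κ
  have hn1' : (1 : ℤ) ≤ (nL κ Φ t p D g f : ℤ) := by exact_mod_cast hn1
  rw [hb]
  unfold Skelφ.yCoreLoS qB3XA Wrun
  push_cast
  set n : ℤ := (nL κ Φ t p D g f : ℤ)
  set ℓ : ℤ := (ℓL κ Φ t p D g f : ℤ)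
  set m := modulus (nL κ Φ t p D g f) (hL κ Φ t p D g f) (vL κ Φ t p D g f) (vβL κ Φ t p D g f) with hm
  set U : ℤ := (shearUnit (nL κ Φ t p D g f) (hL κ Φ t p D g f) : ℤ)
  set u := u₁A κ Φ t p D g f
  set Q : ℤ := (Neg.Kq κ : ℤ)
  set R : ℤ := (RA' κ Φ t p D mk : ℤ)
  set sLo : ℤ := (n * ℓ - U + 1) / U
  set W' : ℤ := n * ℓ / U + 1
  have hmvβ : modulus (nL κ Φ t p D g f) (hL κ Φ t p D g f) (vL κ Φ t p D g f) (Skelφ.NegPrm.vβOf (nL κ Φ t p D g f) (hL κ Φ t p D g f) (ℓL κ Φ t p D g f) (vL κ Φ t p D g f)) = m := rfl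
  rw [hmvβ] at hm1 hm2
  have hk0 : (0 : ℤ) ≤ k := by positivity
  have hR0 : 0 ≤ R := by positivity
  have hm0 : 0 < m := by nlinarith
  -- `U·(yCoreLoS k) = k·(U·sLo) − U·q₃ − k·U·R ≥ k(nℓ − 2U + 2) − U(W' + 1000QR + 2) − kUR`
  have hW : U * W' ≤ n * ℓ + U := hs2
  have h1 : (k : ℤ) * (U * sLo) ≥ (k : ℤ) * (n * ℓ - 2 * U + 2) := mul_le_mul_of_nonneg_left hs1 hk0
  have h2 : m * (u * k) ≤ (n * ℓ) * (u * k) := mul_le_mul_of_nonneg_right hm2 (by nlinarith)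
  have e : u * (U * ((k : ℤ) * sLo - (W' + 1000 * Q * R + 2) - (k : ℤ) * R)) = u * ((k : ℤ) * (U * sLo)) - u * (U * W') - u * (U * (1000 * Q * R + 2)) - u * ((k : ℤ) * U * R) := by ring
  rw [e]
  have h3 : u * ((k : ℤ) * (U * sLo)) ≥ u * ((k : ℤ) * (n * ℓ - 2 * U + 2)) := mul_le_mul_of_nonneg_left h1 (by linarith)
  have h4 : u * (U * W') ≤ u * (n * ℓ + U) := mul_le_mul_of_nonneg_left hW (by linarith)
  -- collect: need `u·(nℓ + U·(2k + 1000QR + kR + 4)) ≤ m·(10Qu − 2u − 5)`, which is `envT` (Z has `+6`)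
  have h5 : u * (U * (2 * (k : ℤ) + (1000 * Q + k) * R + 4)) ≤ u * (U * (2 * (k : ℤ) + (1000 * Q + k) * R + 6)) :=
    mul_le_mul_of_nonneg_left (mul_le_mul_of_nonneg_left (by linarith) (by linarith)) (by linarith)
  nlinarith

/-- **Upper-core envelope**: `u₁·(U·(yCoreHiS k + 1)) ≤ m·(u₁k + b₀₁ − 2u₁ − 5)`. [folklore] -/
theorem coreHi_env (hN : EqNumL κ Φ t p D g f) (hκ : (hL κ Φ t p D g f).natAbs ≤ 10 * nL κ Φ t p D g f) {k : ℕ}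
    (hℓ : 11 * (2 * (k : ℤ) + ((k : ℤ) + 1000 * Neg.Kq κ) * (RA' κ Φ t p D mk : ℤ) + 8) ≤ 2 * (ℓL κ Φ t p D g f : ℤ)) :
    u₁A κ Φ t p D g f * ((shearUnit (nL κ Φ t p D g f) (hL κ Φ t p D g f) : ℤ) *
        (yCoreHiS (nL κ Φ t p D g f) (ℓL κ Φ t p D g f) (hL κ Φ t p D g f) (qB3XA κ Φ t p D g f (RA' κ Φ t p D mk)) (RA' κ Φ t p D mk) k + 1)) ≤
      modulus (nL κ Φ t p D g f) (hL κ Φ t p D g f) (vL κ Φ t p D g f) (vβL κ Φ t p D g f) *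
        (u₁A κ Φ t p D g f * k + (b0TA κ Φ t p D g f 1 : ℤ) - 2 * u₁A κ Φ t p D g f - 5) := by
  obtain ⟨hn1, hℓ1⟩ := one_le_of_eqNumL κ Φ t p D g f hN
  obtain ⟨hm1, hm2⟩ := Skelφ.NegPrm.modulus_vβOf hn1 (hL κ Φ t p D g f) (ℓL κ Φ t p D g f) (vL κ Φ t p D g f)
  obtain ⟨hU1, hU2⟩ := clr_shearUnit_bounds κ Φ t p D g f hκ
  obtain ⟨-, hs2, -⟩ := strideS_bounds κ Φ t p D g f hN
  have henv := envT κ Φ t p D g f mk hN hκ hℓ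
  have hu : 1 ≤ u₁A κ Φ t p D g f := (units_eqA κ Φ t p D g f).2.2.2.2.2.2.2
  have hb : (b0TA κ Φ t p D g f 1 : ℤ) = 10 * (Neg.Kq κ : ℤ) * u₁A κ Φ t p D g f := (units_eqA κ Φ t p D g f).2.2.2.2.2.1
  have hq : (1 : ℤ) ≤ Neg.Kq κ := by exact_mod_cast Neg.one_le_Kq κ
  have hn1' : (1 : ℤ) ≤ (nL κ Φ t p D g f : ℤ) := by exact_mod_cast hn1
  rw [hb]
  unfold Skelφ.yCoreHiS qB3XA Wrun
  push_cast
  set n : ℤ := (nL κ Φ t p D g f : ℤ)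
  set ℓ : ℤ := (ℓL κ Φ t p D g f : ℤ)
  set m := modulus (nL κ Φ t p D g f) (hL κ Φ t p D g f) (vL κ Φ t p D g f) (vβL κ Φ t p D g f) with hm
  set U : ℤ := (shearUnit (nL κ Φ t p D g f) (hL κ Φ t p D g f) : ℤ)
  set u := u₁A κ Φ t p D g f
  set Q : ℤ := (Neg.Kq κ : ℤ)
  set R : ℤ := (RA' κ Φ t p D mk : ℤ)
  set W' : ℤ := n * ℓ / U + 1
  have hmvβ : modulus (nL κ Φ t p D g f) (hL κ Φ t p D g f) (vL κ Φ t p D g f) (Skelφ.NegPrm.vβOf (nL κ Φ t p D g f) (hL κ Φ t p D g f) (ℓL κ Φ t p D g f) (vL κ Φ t p D g f)) = m := rfl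
  rw [hmvβ] at hm1 hm2
  have hk0 : (0 : ℤ) ≤ k := by positivity
  have hR0 : 0 ≤ R := by positivity
  have hm0 : 0 < m := by nlinarith
  have hW : U * W' ≤ n * ℓ + U := hs2
  -- `U·(HiS + 1) = k·(U·W') + U·q₃ + k·U·R + U ≤ k(nℓ + U) + U(W' + 1000QR + 2) + kUR + U`
  have e : u * (U * ((k : ℤ) * W' + (W' + 1000 * Q * R + 2) + (k : ℤ) * R + 1)) = u * ((k : ℤ) * (U * W')) + u * (U * W') + u * (U * (1000 * Q * R + 2)) + u * ((k : ℤ) * U * R) + u * U := by ring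
  rw [e]
  have h1 : u * ((k : ℤ) * (U * W')) ≤ u * ((k : ℤ) * (n * ℓ + U)) := mul_le_mul_of_nonneg_left (mul_le_mul_of_nonneg_left hW hk0) (by linarith)
  have h4 : u * (U * W') ≤ u * (n * ℓ + U) := mul_le_mul_of_nonneg_left hW (by linarith)
  have h2 : (n * ℓ - n) * (u * k) ≤ m * (u * k) := mul_le_mul_of_nonneg_right hm1.le (by nlinarith)
  have h6 : u * ((k : ℤ) * n) ≤ u * ((k : ℤ) * U) := mul_le_mul_of_nonneg_left (mul_le_mul_of_nonneg_left hU1 hk0) (by linarith)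
  have h5 : u * (U * (2 * (k : ℤ) + (1000 * Q + k) * R + 4)) ≤ u * (U * (2 * (k : ℤ) + (1000 * Q + k) * R + 6)) :=
    mul_le_mul_of_nonneg_left (mul_le_mul_of_nonneg_left (by linarith) (by linarith)) (by linarith)
  nlinarith

/-- `yCoreLoS k ≤ yCoreHiS k`. [folklore] -/
theorem coreLo_le_Hi (hN : EqNumL κ Φ t p D g f) (q R' k : ℕ) :
    yCoreLoS (nL κ Φ t p D g f) (ℓL κ Φ t p D g f) (hL κ Φ t p D g f) q R' k ≤ yCoreHiS (nL κ Φ t p D g f) (ℓL κ Φ t p D g f) (hL κ Φ t p D g f) q R' k := by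
  obtain ⟨-, -, hs3⟩ := strideS_bounds κ Φ t p D g f hN
  unfold Skelφ.yCoreLoS Skelφ.yCoreHiS
  have hk0 : (0 : ℤ) ≤ k := by positivity
  have h1 := mul_le_mul_of_nonneg_left hs3 hk0
  have : (0 : ℤ) ≤ q := by positivity
  have : (0 : ℤ) ≤ (k : ℤ) * R' := by positivity
  linarith

/-- The signed core ends at `τ = 1` and `τ = −1`. [folklore] -/
theorem yCS_eval (hN : EqNumL κ Φ t p D g f) (q R' k : ℕ) :
    yCSLo (nL κ Φ t p D g f) (ℓL κ Φ t p D g f) (hL κ Φ t p D g f) q R' 1 k = yCoreLoS (nL κ Φ t p D g f) (ℓL κ Φ t p D g f) (hL κ Φ t p D g f) q R' k ∧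
      yCSHi (nL κ Φ t p D g f) (ℓL κ Φ t p D g f) (hL κ Φ t p D g f) q R' 1 k = yCoreHiS (nL κ Φ t p D g f) (ℓL κ Φ t p D g f) (hL κ Φ t p D g f) q R' k ∧
      yCSLo (nL κ Φ t p D g f) (ℓL κ Φ t p D g f) (hL κ Φ t p D g f) q R' (-1) k = -yCoreHiS (nL κ Φ t p D g f) (ℓL κ Φ t p D g f) (hL κ Φ t p D g f) q R' k ∧
      yCSHi (nL κ Φ t p D g f) (ℓL κ Φ t p D g f) (hL κ Φ t p D g f) q R' (-1) k = -yCoreLoS (nL κ Φ t p D g f) (ℓL κ Φ t p D g f) (hL κ Φ t p D g f) q R' k := by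
  have h := coreLo_le_Hi κ Φ t p D g f hN q R' k
  unfold Skelφ.yCSLo Skelφ.yCSHi
  refine ⟨?_, ?_, ?_, ?_⟩
  · rw [one_mul, one_mul]; exact min_eq_left h
  · rw [one_mul, one_mul]; exact max_eq_right h
  · rw [neg_one_mul, neg_one_mul]; exact min_eq_right (by linarith)
  · rw [neg_one_mul, neg_one_mul]; exact max_eq_left (by linarith)

/-- **`FL3` generic** (any origin `yL`, tangential sign `σT = ±1`, core index `k` within `2u₁` of the target). [cite: KozmaNitzan2024, §4 Lemma 12 (pp. 23–25)] -/
theorem FL3_XA_gen (hN : EqNumL κ Φ t p D g f) (hκ : (hL κ Φ t p D g f).natAbs ≤ 10 * nL κ Φ t p D g f) (x : Site 2) (du : MDir) (hd : du.1 = 0) (z : Site 2)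
    (yL : Site 2) {σT : ℤ} (hσT : σT = 1 ∨ σT = -1) (σ : ℤ) (Nr : ℕ) {k : ℕ}
    (hNT : |F1cA κ Φ t p D g f yL + σT * u₁A κ Φ t p D g f * (k : ℤ) - T1X κ Φ t p D g f x z| ≤ 2 * u₁A κ Φ t p D g f)
    (hℓ : 11 * (2 * (k : ℤ) + ((k : ℤ) + 1000 * Neg.Kq κ) * (RA' κ Φ t p D mk : ℤ) + 8) ≤ 2 * (ℓL κ Φ t p D g f : ℤ)) :
    modulus (nL κ Φ t p D g f) (hL κ Φ t p D g f) (vL κ Φ t p D g f) (vβL κ Φ t p D g f) *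
        ((fcellsA κ Φ t p D g f).cen (x + stepVec du) 1 - (b0TA κ Φ t p D g f 1 : ℤ) + 2 - z 1 -
          F1cA κ Φ t p D g f (yL + crossOffX (nL κ Φ t p D g f) (hL κ Φ t p D g f) (vL κ Φ t p D g f) σ σT Nr)) ≤
      u₁A κ Φ t p D g f * ((shearUnit (nL κ Φ t p D g f) (hL κ Φ t p D g f) : ℤ) *
          (yCSLo (nL κ Φ t p D g f) (ℓL κ Φ t p D g f) (hL κ Φ t p D g f) (qB3XA κ Φ t p D g f (RA' κ Φ t p D mk)) (RA' κ Φ t p D mk) σT k - 1)) -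
        modulus (nL κ Φ t p D g f) (hL κ Φ t p D g f) (vL κ Φ t p D g f) (vβL κ Φ t p D g f) + 1 := by
  obtain ⟨hn1, hℓ1⟩ := one_le_of_eqNumL κ Φ t p D g f hN
  have hm0 : 0 < modulus (nL κ Φ t p D g f) (hL κ Φ t p D g f) (vL κ Φ t p D g f) (vβL κ Φ t p D g f) := Skelφ.NegPrm.modulus_vβOf_pos hn1 hℓ1 _ _
  have hu : 1 ≤ u₁A κ Φ t p D g f := (units_eqA κ Φ t p D g f).2.2.2.2.2.2.2
  have hsh := F1cA_yTX0_sub_abs_le κ Φ t p D g f hN yL σT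
  rw [F1cA_crossOffX, cen_step_one κ Φ t p D g f x du hd]
  obtain ⟨s1, s2⟩ := abs_le.1 hsh
  obtain ⟨t1, t2⟩ := abs_le.1 hNT
  obtain ⟨e1, e2, e3, e4⟩ := yCS_eval κ Φ t p D g f hN (qB3XA κ Φ t p D g f (RA' κ Φ t p D mk)) (RA' κ Φ t p D mk) k
  have hLo := coreLo_env κ Φ t p D g f mk hN hκ hℓ
  have hHi := coreHi_env κ Φ t p D g f mk hN hκ hℓ
  have hT1 : T1X κ Φ t p D g f x z = (fcellsA κ Φ t p D g f).cen x 1 - z 1 := rfl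
  set m := modulus (nL κ Φ t p D g f) (hL κ Φ t p D g f) (vL κ Φ t p D g f) (vβL κ Φ t p D g f)
  set u := u₁A κ Φ t p D g f
  set U : ℤ := (shearUnit (nL κ Φ t p D g f) (hL κ Φ t p D g f) : ℤ)
  set f₁ := F1cA κ Φ t p D g f (yTX0 κ Φ t p D g f yL σT)
  set F := F1cA κ Φ t p D g f yL
  set T := T1X κ Φ t p D g f x z
  set b : ℤ := (b0TA κ Φ t p D g f 1 : ℤ)
  have eT : (fcellsA κ Φ t p D g f).cen x 1 - b + 2 - z 1 - f₁ = T - b + 2 - f₁ := by rw [hT1]; ring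
  rw [eT]
  rcases hσT with hs | hs
  · -- `σT = 1`: the core's lower end is `yCoreLoS`; `f₁ ≥ T − u·k − 2u − 2`
    rw [hs] at t1 t2 ⊢
    rw [e1]
    have hf : T - f₁ ≤ u * k + 2 * u + 2 := by nlinarith
    have h1 : m * (T - b + 2 - f₁) ≤ m * (u * k + 2 * u + 4 - b) := mul_le_mul_of_nonneg_left (by linarith) hm0.le
    nlinarith
  · -- `σT = −1`: the core's lower end is `−yCoreHiS`; `f₁ ≥ T + u·k − 2u − 2`
    rw [hs] at t1 t2 ⊢
    rw [e3]
    have hf : T - f₁ ≤ -(u * k) + 2 * u + 2 := by nlinarith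
    have h1 : m * (T - b + 2 - f₁) ≤ m * (-(u * k) + 2 * u + 4 - b) := mul_le_mul_of_nonneg_left (by linarith) hm0.le
    nlinarith

/-- **`FL4` generic** (any origin `yL`, tangential sign `σT = ±1`, core index `k` within `2u₁` of the target). [cite: KozmaNitzan2024, §4 Lemma 12 (pp. 23–25)] -/
theorem FL4_XA_gen (hN : EqNumL κ Φ t p D g f) (hκ : (hL κ Φ t p D g f).natAbs ≤ 10 * nL κ Φ t p D g f) (x : Site 2) (du : MDir) (hd : du.1 = 0) (z : Site 2)
    (yL : Site 2) {σT : ℤ} (hσT : σT = 1 ∨ σT = -1) (σ : ℤ) (Nr : ℕ) {k : ℕ}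
    (hNT : |F1cA κ Φ t p D g f yL + σT * u₁A κ Φ t p D g f * (k : ℤ) - T1X κ Φ t p D g f x z| ≤ 2 * u₁A κ Φ t p D g f)
    (hℓ : 11 * (2 * (k : ℤ) + ((k : ℤ) + 1000 * Neg.Kq κ) * (RA' κ Φ t p D mk : ℤ) + 8) ≤ 2 * (ℓL κ Φ t p D g f : ℤ)) :
    modulus (nL κ Φ t p D g f) (hL κ Φ t p D g f) (vL κ Φ t p D g f) (vβL κ Φ t p D g f) *
          (F1cA κ Φ t p D g f (yL + crossOffX (nL κ Φ t p D g f) (hL κ Φ t p D g f) (vL κ Φ t p D g f) σ σT Nr) + 1) +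
        u₁A κ Φ t p D g f * ((shearUnit (nL κ Φ t p D g f) (hL κ Φ t p D g f) : ℤ) *
            yCSHi (nL κ Φ t p D g f) (ℓL κ Φ t p D g f) (hL κ Φ t p D g f) (qB3XA κ Φ t p D g f (RA' κ Φ t p D mk)) (RA' κ Φ t p D mk) σT k +
          shearUnit (nL κ Φ t p D g f) (hL κ Φ t p D g f) - 1) ≤
      modulus (nL κ Φ t p D g f) (hL κ Φ t p D g f) (vL κ Φ t p D g f) (vβL κ Φ t p D g f) *
        ((fcellsA κ Φ t p D g f).cen (x + stepVec du) 1 + (b0TA κ Φ t p D g f 1 : ℤ) - 2 - z 1) := by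
  obtain ⟨hn1, hℓ1⟩ := one_le_of_eqNumL κ Φ t p D g f hN
  have hm0 : 0 < modulus (nL κ Φ t p D g f) (hL κ Φ t p D g f) (vL κ Φ t p D g f) (vβL κ Φ t p D g f) := Skelφ.NegPrm.modulus_vβOf_pos hn1 hℓ1 _ _
  have hu : 1 ≤ u₁A κ Φ t p D g f := (units_eqA κ Φ t p D g f).2.2.2.2.2.2.2
  have hsh := F1cA_yTX0_sub_abs_le κ Φ t p D g f hN yL σT
  rw [F1cA_crossOffX, cen_step_one κ Φ t p D g f x du hd]
  obtain ⟨s1, s2⟩ := abs_le.1 hsh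
  obtain ⟨t1, t2⟩ := abs_le.1 hNT
  obtain ⟨e1, e2, e3, e4⟩ := yCS_eval κ Φ t p D g f hN (qB3XA κ Φ t p D g f (RA' κ Φ t p D mk)) (RA' κ Φ t p D mk) k
  have hLo := coreLo_env κ Φ t p D g f mk hN hκ hℓ
  have hHi := coreHi_env κ Φ t p D g f mk hN hκ hℓ
  have hT1 : T1X κ Φ t p D g f x z = (fcellsA κ Φ t p D g f).cen x 1 - z 1 := rfl
  set m := modulus (nL κ Φ t p D g f) (hL κ Φ t p D g f) (vL κ Φ t p D g f) (vβL κ Φ t p D g f)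
  set u := u₁A κ Φ t p D g f
  set U : ℤ := (shearUnit (nL κ Φ t p D g f) (hL κ Φ t p D g f) : ℤ)
  set f₁ := F1cA κ Φ t p D g f (yTX0 κ Φ t p D g f yL σT)
  set F := F1cA κ Φ t p D g f yL
  set T := T1X κ Φ t p D g f x z
  set b : ℤ := (b0TA κ Φ t p D g f 1 : ℤ)
  have eT : (fcellsA κ Φ t p D g f).cen x 1 + b - 2 - z 1 = T + b - 2 := by rw [hT1]; ring
  rw [eT]
  rcases hσT with hs | hs
  · rw [hs] at t1 t2 ⊢
    rw [e2]
    have hf : f₁ ≤ T - u * k + 2 * u + 2 := by nlinarith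
    have h1 : m * (f₁ + 1) ≤ m * (T - u * k + 2 * u + 3) := mul_le_mul_of_nonneg_left (by linarith) hm0.le
    nlinarith
  · rw [hs] at t1 t2 ⊢
    rw [e4]
    have hf : f₁ ≤ T + u * k + 2 * u + 2 := by nlinarith
    have h1 : m * (f₁ + 1) ≤ m * (T + u * k + 2 * u + 3) := mul_le_mul_of_nonneg_left (by linarith) hm0.le
    nlinarith

/-- **`FL3` pinned** at the M3 skeleton's choice functions (`σT := σTX`, `N₃ := N3X`, `Nr := NrX`). [cite: KozmaNitzan2024, §4 Lemma 12 (pp. 23–25)] -/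
theorem FL3_XA (hN : EqNumL κ Φ t p D g f) (hκ : (hL κ Φ t p D g f).natAbs ≤ 10 * nL κ Φ t p D g f)
    (hnA : 2000 * Neg.Kq κ * (RA' κ Φ t p D mk + 2) ≤ nL κ Φ t p D g f) (hℓA : 22000 * Neg.Kq κ * (RA' κ Φ t p D mk + 2) ≤ ℓL κ Φ t p D g f)
    (x : Site 2) (du : MDir) (hd : du.1 = 0) (z : Site 2) {kE : ℤ}
    (hz : |z 1 - (fcellsA κ Φ t p D g f).cen x 1| ≤ kE) (hkE : kE ≤ 5 * ((fcellsA κ Φ t p D g f).r 1 : ℤ))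
    (yL : Site 2)
    (he1 : |F1cA κ Φ t p D g f yL| ≤ 6 * u₁A κ Φ t p D g f) :
    (modulus (nL κ Φ t p D g f) (hL κ Φ t p D g f) (vL κ Φ t p D g f) (vβL κ Φ t p D g f)) * ((fcellsA κ Φ t p D g f).cen (x + stepVec du) 1 - (b0TA κ Φ t p D g f) 1 + 2 - z 1 - coarse (prFA κ Φ t p D g f).c₁ ((prFA κ Φ t p D g f).D / 2) (prFA κ Φ t p D g f).D (lam1 (prFA κ Φ t p D g f).A (nL κ Φ t p D g f) (prFA κ Φ t p D g f).h (yL + crossOffX (nL κ Φ t p D g f) (prFA κ Φ t p D g f).h (prFA κ Φ t p D g f).vα (sgOf du) (σTX κ Φ t p D g f yL x z) (NrX κ Φ t p D g f yL (σTX κ Φ t p D g f yL x z) x du z)))) ≤ (((fcellsA κ Φ t p D g f).s 1 : ℕ) : ℤ) * ((shearUnit (nL κ Φ t p D g f) (prFA κ Φ t p D g f).h : ℤ) * (yCSLo (nL κ Φ t p D g f) (ℓL κ Φ t p D g f) (prFA κ Φ t p D g f).h (qB3XA κ Φ t p D g f (RA' κ Φ t p D mk)) (RA' κ Φ t p D mk)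 (σTX κ Φ t p D g f yL x z) ((N3X κ Φ t p D g f yL x z) + 1) - 1)) - (modulus (nL κ Φ t p D g f) (hL κ Φ t p D g f) (vL κ Φ t p D g f) (vβL κ Φ t p D g f)) + 1   := by
  obtain ⟨hσT, -, hNT⟩ := N3X_spec κ Φ t p D g f yL x z
  have hN3 := N3X_range κ Φ t p D g f yL x z hz hkE he1 (by linarith [(units_eqA κ Φ t p D g f).2.2.2.2.2.2.2])
  obtain ⟨-, hℓ⟩ := floorsL_conds κ Φ t p D g f mk hN3 hnA hℓA
  have hNT' : |F1cA κ Φ t p D g f yL + σTX κ Φ t p D g f yL x z * u₁A κ Φ t p D g f * (((N3X κ Φ t p D g f yL x z + 1 : ℕ)) : ℤ) -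
      T1X κ Φ t p D g f x z| ≤ 2 * u₁A κ Φ t p D g f := by push_cast; exact hNT
  exact FL3_XA_gen κ Φ t p D g f mk hN hκ x du hd z yL hσT (sgOf du) _ hNT' hℓ

/-- **`FL4` pinned** at the M3 skeleton's choice functions. [cite: KozmaNitzan2024, §4 Lemma 12 (pp. 23–25)] -/
theorem FL4_XA (hN : EqNumL κ Φ t p D g f) (hκ : (hL κ Φ t p D g f).natAbs ≤ 10 * nL κ Φ t p D g f)
    (hnA : 2000 * Neg.Kq κ * (RA' κ Φ t p D mk + 2) ≤ nL κ Φ t p D g f) (hℓA : 22000 * Neg.Kq κ * (RA' κ Φ t p D mk + 2) ≤ ℓL κ Φ t p D g f)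
    (x : Site 2) (du : MDir) (hd : du.1 = 0) (z : Site 2) {kE : ℤ}
    (hz : |z 1 - (fcellsA κ Φ t p D g f).cen x 1| ≤ kE) (hkE : kE ≤ 5 * ((fcellsA κ Φ t p D g f).r 1 : ℤ))
    (yL : Site 2)
    (he1 : |F1cA κ Φ t p D g f yL| ≤ 6 * u₁A κ Φ t p D g f) :
    (modulus (nL κ Φ t p D g f) (hL κ Φ t p D g f) (vL κ Φ t p D g f) (vβL κ Φ t p D g f)) * (coarse (prFA κ Φ t p D g f).c₁ ((prFA κ Φ t p D g f).D / 2) (prFA κ Φ t p D g f).D (lam1 (prFA κ Φ t p D g f).A (nL κ Φ t p D g f) (prFA κ Φ t p D g f).h (yL + crossOffX (nL κ Φ t p D g f) (prFA κ Φ t p D g f).h (prFA κ Φ t p D g f).vα (sgOf du) (σTX κ Φ t p D g f yL x z) (NrX κ Φ t p D g f yL (σTX κ Φ t p D g f yL x z) x du z))) + 1) + (((fcellsA κ Φ t p D g f).s 1 : ℕ) : ℤ) * ((shearUnit (nL κ Φ t p D g f) (prFA κ Φ t p D g f).h : ℤ) * yCSHi (nL κ Φ t p D g f) (ℓL κ Φ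 t p D g f) (prFA κ Φ t p D g f).h (qB3XA κ Φ t p D g f (RA' κ Φ t p D mk)) (RA' κ Φ t p D mk) (σTX κ Φ t p D g f yL x z) ((N3X κ Φ t p D g f yL x z) + 1) + shearUnit (nL κ Φ t p D g f) (prFA κ Φ t p D g f).h - 1) ≤ (modulus (nL κ Φ t p D g f) (hL κ Φ t p D g f) (vL κ Φ t p D g f) (vβL κ Φ t p D g f)) * ((fcellsA κ Φ t p D g f).cen (x + stepVec du) 1 + (b0TA κ Φ t p D g f) 1 - 2 - z 1)   := by
  obtain ⟨hσT, -, hNT⟩ := N3X_spec κ Φ t p D g f yL x z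
  have hN3 := N3X_range κ Φ t p D g f yL x z hz hkE he1 (by linarith [(units_eqA κ Φ t p D g f).2.2.2.2.2.2.2])
  obtain ⟨-, hℓ⟩ := floorsL_conds κ Φ t p D g f mk hN3 hnA hℓA
  have hNT' : |F1cA κ Φ t p D g f yL + σTX κ Φ t p D g f yL x z * u₁A κ Φ t p D g f * (((N3X κ Φ t p D g f yL x z + 1 : ℕ)) : ℤ) -
      T1X κ Φ t p D g f x z| ≤ 2 * u₁A κ Φ t p D g f := by push_cast; exact hNT
  exact FL4_XA_gen κ Φ t p D g f mk hN hκ x du hd z yL hσT (sgOf du) _ hNT' hℓ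

end FloorsL2

end KS

end NegB

end PlanarSkeletonNeg

end Summit.CriticalPhenomena.PercolationContinuityZ3.Theorems.Transplant

end
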